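import Summits.Ventures.PercRepro.S2LPUnsplit

/-!
# PercRepro — THE CLOSURE INSTANCES AT THE TOP RANK (p2, gen 30; the level-5 coloop/closure LP, SUBCLAIM-S2 feeder)

The closure incidences of `S2LPIncidence` / `S2LPUnsplit` with the trivial extension bound `n − k` (every point
outside a `k`-set is an extension), for the rank classes at the rank of the matroid, where no flat bound applies.
Nothing is claimed about any cell.

* `ncard_extensions_le_sub`, `cl_exact_any`, `cl_inst_any`, `rkSets_eq_empty_of_lt_two`.
Axioms: standard.
-/

open scoped Matroid

namespace PercRepro

namespace S2LP

open Set Finset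

variable {α : Type} {M : Matroid α} [M.Finite]

/-- The extensions of a `k`-set are at most the `n − k` points outside it. -/
theorem ncard_extensions_le_sub {A : Set α} (hAE : A ⊆ M.E) {k b : ℕ} (hAk : A.ncard = k) :
    {x ∈ M.E \ A | M.eRk (insert x A) = (b : ℕ∞)}.ncard ≤ M.E.ncard - k := by
  calc {x ∈ M.E \ A | M.eRk (insert x A) = (b : ℕ∞)}.ncard ≤ (M.E \ A).ncard :=
        ncard_le_ncard (fun _ h => h.1) (M.ground_finite.subset sdiff_subset)
    _ = M.E.ncard - k := by rw [ncard_sdiff' hAE M.ground_finite, hAk]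

/-- **THE EXACT CLOSURE INSTANCE WITH THE TRIVIAL BOUND**: for `b ≤ k`,
`Σ_s s·#nuSets (k+1) (k − b + 1) s ≤ (n − k)·m[k, b]`. -/
theorem cl_exact_any (k b : ℕ) (hb : b ≤ k) :
    ∑ s ∈ Finset.range (k + 2), s * (nuSets M (k + 1) (k - b + 1) s).ncard ≤
      (M.E.ncard - k) * (S1.rkSets M k b).ncard :=
  closure_exact k b _ hb (fun _ hAE hAk _ => ncard_extensions_le_sub hAE hAk)

/-- **THE UNSPLIT CLOSURE INSTANCE WITH THE TRIVIAL BOUND**: for `b ≤ k`,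
`(k − b + 1 + rminL (k − b + 1))·m[k+1,b] ≤ (n − k)·m[k,b]`. -/
theorem cl_inst_any (hpairs : ∀ e ∈ M.E, ∀ f ∈ M.E, e ≠ f → M.eRk {e, f} = 2)
    (hlines : ∀ L ⊆ M.E, M.eRk L = 2 → L.ncard ≤ 3) (hplanes : ∀ P ⊆ M.E, M.eRk P ≤ 3 → P.ncard ≤ 6)
    (htens : ∀ X ⊆ M.E, M.eRk X ≤ 4 → X.ncard ≤ 10) (hnineteen : ∀ X ⊆ M.E, M.eRk X ≤ 5 → X.ncard ≤ 19)
    (hE2 : 2 ≤ M.E.ncard) (k b : ℕ) (hbk : b ≤ k) :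
    (k - b + 1 + rminL (k - b + 1)) * (S1.rkSets M (k + 1) b).ncard ≤
      (M.E.ncard - k) * (S1.rkSets M k b).ncard :=
  S1.closure_incidence k b _ _ (fun _ hS hSk hSb => lower_fibre hpairs hlines hplanes htens hnineteen hE2 k b hbk hS hSk hSb)
    (fun _ hAE hAk _ => ncard_extensions_le_sub hAE hAk)

/-- In a simple matroid no `k`-set with `k ≥ 2` has rank below `2`. -/
theorem rkSets_eq_empty_of_lt_two (hpairs : ∀ e ∈ M.E, ∀ f ∈ M.E, e ≠ f → M.eRk {e, f} = 2) {k r : ℕ}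
    (hk : 2 ≤ k) (hr : r < 2) : S1.rkSets M k r = ∅ := by
  ext S
  simp only [mem_empty_iff_false, iff_false]
  rintro ⟨hSE, hSk, hSr⟩
  have := S1.two_le_eRk_of_two_le_ncard hpairs hSE (by omega)
  rw [hSr] at this
  have h2 : 2 ≤ r := by exact_mod_cast this
  omega

end S2LP

end PercRepro
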